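import Summits.BirchSwinnertonDyer.BirchSwinnertonDyer.Theorems.KatoDescentTamePotSupersingularCartanMuRoadRealDoorsNoGrowth
import Summits.BirchSwinnertonDyer.BirchSwinnertonDyer.Theorems.KatoDescentTamePotSupersingularCartanMuRoadFukudaDoorsTprime
import Literature.NumberTheory.IwasawaTheory.Fukuda1994Thm1Proofs
import Literature.NumberTheory.IwasawaTheory.Fukuda1994Thm1RankProofs
import HarnessLib

/-!
# KT / K9 `p = 3` Cartan μ-road — the FUKUDA DOORS with EVERY dischargeable named fact discharged: (A) at `(W,3)` and U₀ `MissingUpperBoundAt W 3`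
# from the mod-3 image predicate, a complex conjugation and ONE integer equality at two consecutive layers of the cyclotomic `ℤ_3`-tower of
# `ℚ(P) = ℚ(W[3])⁺` (`e_{n+1} = e_n` or `rank₃ Cl_{n+1} = rank₃ Cl_n`), modulo Ferrero–Washington ALONE (+ `hKatoA hGZK hmod` for U₀)
# (cell `bsd-potss`, seat `bsd-potss-k8t-c4` g22; route-free; `--supports stmt-BirchSwinnertonDyer-19982 --as helper`; closes nothing)

HONEST FRAMING. Route-free THEOREMS ONLY (no definition, no named fact, no `sorry`). g19's `CartanMuRoadFukudaDoorsTprime` (p651597 / hF1-free p670543 /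
hF2-free `…F2` p682263) displayed, besides `hFW`, the named facts `hCS` (Coates–Sujatha 3.4), `hF1` / `hF2` (Fukuda 1994 Thm. 1 (1)/(2)) and on `3Nn` rows
`hI` (Iwasawa growth). All four are now tree theorems or unnecessary: `fukuda1994_thm1_classNumberPExp_const_of_succ_eq_holds` (g19, p669438),
`fukuda1994_thm1_classGroupPRank_const_of_succ_eq_holds` (g20, p681350), `CoatesSujatha2005.thm34_…_holds` (g22, p694085), and the hI-free doors
`CartanMuRoadRealDoorsNoGrowth` (g22). THIS FILE composes them: §1 (A) at `(W,3)` (any elliptic `W/ℚ`; K9 and KT), §2 U₀ on a rank-`0` (t′) row, §3 U₀ on a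
rank-`0` O6 row (K9 courtesy) — each from {image predicate, `W[3]` irreducible (for Fukuda's index `n₀ = 0`,
`totallyRamifiedFrom_zero_intermediateField_divisionField`), `c`, ONE displayed integer equality `hord` / `hrk`}, modulo `hFW` only.
Nothing is asserted about any curve; (A), Conjecture A and BSD are proved for no curve here.
[cite: Fukuda1994, Thm. 1, p. 264] [cite: CoatesSujatha2005, Thm. 3.4 (§3)] [cite: Kato2004Asterisque, Thm. 14.5 (3) (p. 236)]
[cite: Serre1972, §2.4 Prop. 15, §5.2 (iv)] [cite: Washington1997, §13.1, §13.3 Prop. 13.23]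
-/

set_option linter.dupNamespace false
set_option autoImplicit false

noncomputable section

open scoped Classical NumberField
open Field IntermediateField WeierstrassCurve Literature.NumberTheory.EllipticCurves
  Literature.NumberTheory.EllipticCurves.Rank1Residual
  Literature.NumberTheory.EllipticCurves.Rank1Residual.Typed
  Literature.NumberTheory.GaloisRepresentations Literature.NumberTheory.SerreUniformity
  Literature.NumberTheory.IwasawaTheory
  Summit.BirchSwinnertonDyer.Rank1Residual Summit.BirchSwinnertonDyer.Rank1Residual.Additive

namespace Summit.BirchSwinnertonDyer.BirchSwinnertonDyer.Theorems.CartanMuRoadFukudaDoorsNoGrowth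

/-! ### §1 (A) at `(W, 3)` from ONE integer equality on the tower of `ℚ(P)`, modulo Ferrero–Washington alone -/

section FukudaDoors

variable (W : WeierstrassCurve ℚ) [W.IsElliptic]

/-- **(A) at `(W,3)` on a `3Ns` row from `ord₃ h(ℚ(P)_{n+1}) = ord₃ h(ℚ(P)_n)`** (Fukuda Thm. 1 (1), PROVED), modulo `hFW` alone. CONDITIONAL; (A) asserted
for no curve. [cite: Fukuda1994, Thm. 1 (1), p. 264] [cite: CoatesSujatha2005, Thm. 3.4 (§3)] [cite: Serre1972, §2.4 Prop. 15, §5.2 (iv)] -/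
theorem conjA_three_of_hasSplitCartanNormalizerModPImage_of_realSuccEqAt
    (hFW : ferreroWashington1979_classicalMuVanishes)
    (hirr : W.HasIrreducibleModPGaloisRep 3) (himg : HasSplitCartanNormalizerModPImage W 3)
    {c : absoluteGaloisGroup ℚ} (hc : IsComplexConjugation (Rat.castHom ℝ) c) (n : ℕ)
    (hord : ∀ κE : ZpExtension ↥(fixedField (Subgroup.zpowers (absRestrictNormalHom (W.divisionField 3) c))) 3,
      κE.IsCyclotomic → classNumberPExp κE (n + 1) = classNumberPExp κE n)
    (κ : ZpExtension ℚ 3) (hκ : κ.IsCyclotomic) :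
    ∃ (γ : absoluteGaloisGroup ℚ) (D : W.FineSelmerDualData κ γ),
      Module.Finite ℤ_[3] (RestrictScalars ℤ_[3] (IwasawaAlgebra 3) D.X) := by
  haveI : Fact (Nat.Prime 3) := ⟨Nat.prime_three⟩
  haveI : NumberField ↥(W.divisionField 3) := NumberField.mk
  exact CartanMuRoadRealDoorsNoGrowth.conjA_three_of_hasSplitCartanNormalizerModPImage_of_realMu W hFW himg hc
    (fun κE hκE => classicalMuVanishes_of_classNumberPExp_succ_eq fukuda1994_thm1_classNumberPExp_const_of_succ_eq_holds κE
      (CartanMuRoadFukudaDoorsTprime.totallyRamifiedFrom_zero_intermediateField_divisionField W 3 hirr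
        (CartanMuRoadFukudaDoorsTprime.not_hasSurjectiveModNGaloisRep_of_hasSplitCartanNormalizerModPImage W himg) _ κE hκE)
      (Nat.zero_le n) (hord κE hκE)) κ hκ

/-- **(A) at `(W,3)` on a `3Ns` row from `rank₃ Cl(ℚ(P)_{n+1}) = rank₃ Cl(ℚ(P)_n)`** (Fukuda Thm. 1 (2), PROVED), modulo `hFW` alone. CONDITIONAL.
[cite: Fukuda1994, Thm. 1 (2), p. 264] [cite: CoatesSujatha2005, Thm. 3.4 (§3)] [cite: Serre1972, §2.4 Prop. 15, §5.2 (iv)] -/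
theorem conjA_three_of_hasSplitCartanNormalizerModPImage_of_realRankSuccEqAt
    (hFW : ferreroWashington1979_classicalMuVanishes)
    (hirr : W.HasIrreducibleModPGaloisRep 3) (himg : HasSplitCartanNormalizerModPImage W 3)
    {c : absoluteGaloisGroup ℚ} (hc : IsComplexConjugation (Rat.castHom ℝ) c) (n : ℕ)
    (hrk : ∀ κE : ZpExtension ↥(fixedField (Subgroup.zpowers (absRestrictNormalHom (W.divisionField 3) c))) 3,
      κE.IsCyclotomic → classGroupPRank κE (n + 1) = classGroupPRank κE n)
    (κ : ZpExtension ℚ 3) (hκ : κ.IsCyclotomic) :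
    ∃ (γ : absoluteGaloisGroup ℚ) (D : W.FineSelmerDualData κ γ),
      Module.Finite ℤ_[3] (RestrictScalars ℤ_[3] (IwasawaAlgebra 3) D.X) := by
  haveI : Fact (Nat.Prime 3) := ⟨Nat.prime_three⟩
  haveI : NumberField ↥(W.divisionField 3) := NumberField.mk
  exact CartanMuRoadRealDoorsNoGrowth.conjA_three_of_hasSplitCartanNormalizerModPImage_of_realMu W hFW himg hc
    (fun κE hκE => classicalMuVanishes_of_classGroupPRank_succ_eq fukuda1994_thm1_classGroupPRank_const_of_succ_eq_holds κE
      (CartanMuRoadFukudaDoorsTprime.totallyRamifiedFrom_zero_intermediateField_divisionField W 3 hirr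
        (CartanMuRoadFukudaDoorsTprime.not_hasSurjectiveModNGaloisRep_of_hasSplitCartanNormalizerModPImage W himg) _ κE hκE)
      (Nat.zero_le n) (hrk κE hκE)) κ hκ

/-- **(A) at `(W,3)` on a `3Nn` row from `ord₃ h(ℚ(P)_{n+1}) = ord₃ h(ℚ(P)_n)` on the octic `ℚ(P)` ALONE** (Fukuda Thm. 1 (1) PROVED; NO growth theorem),
modulo `hFW` alone — the door for the 19 KT `3Nn` U₀-ns rows graded FUKUDA-L(0,1). CONDITIONAL. [cite: Fukuda1994, Thm. 1 (1), p. 264]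
[cite: CoatesSujatha2005, Thm. 3.4 (§3)] [cite: Serre1972, §2.4 Prop. 15, §5.2 (iv)] [cite: Washington1997, §13.3 Prop. 13.23] -/
theorem conjA_three_of_hasModPImageEqNonsplitCartanNormalizer_of_realSuccEqAt
    (hFW : ferreroWashington1979_classicalMuVanishes)
    (hirr : W.HasIrreducibleModPGaloisRep 3) (himg : HasModPImageEqNonsplitCartanNormalizer W 3)
    {c : absoluteGaloisGroup ℚ} (hc : IsComplexConjugation (Rat.castHom ℝ) c) (n : ℕ)
    (hord : ∀ κE : ZpExtension ↥(fixedField (Subgroup.zpowers (absRestrictNormalHom (W.divisionField 3) c))) 3,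
      κE.IsCyclotomic → classNumberPExp κE (n + 1) = classNumberPExp κE n)
    (κ : ZpExtension ℚ 3) (hκ : κ.IsCyclotomic) :
    ∃ (γ : absoluteGaloisGroup ℚ) (D : W.FineSelmerDualData κ γ),
      Module.Finite ℤ_[3] (RestrictScalars ℤ_[3] (IwasawaAlgebra 3) D.X) := by
  haveI : Fact (Nat.Prime 3) := ⟨Nat.prime_three⟩
  haveI : NumberField ↥(W.divisionField 3) := NumberField.mk
  exact CartanMuRoadRealDoorsNoGrowth.conjA_three_of_hasModPImageEqNonsplitCartanNormalizer_of_realMu W hFW himg hc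
    (fun κE hκE => classicalMuVanishes_of_classNumberPExp_succ_eq fukuda1994_thm1_classNumberPExp_const_of_succ_eq_holds κE
      (CartanMuRoadFukudaDoorsTprime.totallyRamifiedFrom_zero_intermediateField_divisionField W 3 hirr
        (not_hasSurjectiveModNGaloisRep_of_hasNonsplitCartanModPImage W himg.hasNonsplitCartanModPImage) _ κE hκE)
      (Nat.zero_le n) (hord κE hκE)) κ hκ

/-- **(A) at `(W,3)` on a `3Nn` row from `rank₃ Cl(ℚ(P)_{n+1}) = rank₃ Cl(ℚ(P)_n)` on the octic `ℚ(P)` ALONE** (Fukuda Thm. 1 (2) PROVED; NO growth theorem),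
modulo `hFW` alone — the door for the KT rows 198927v1, 486720db1, 486720dc1 (RANK-STABLE at `(0,1)`). CONDITIONAL. [cite: Fukuda1994, Thm. 1 (2), p. 264]
[cite: CoatesSujatha2005, Thm. 3.4 (§3)] [cite: Serre1972, §2.4 Prop. 15, §5.2 (iv)] [cite: Washington1997, §13.3 Prop. 13.23] -/
theorem conjA_three_of_hasModPImageEqNonsplitCartanNormalizer_of_realRankSuccEqAt
    (hFW : ferreroWashington1979_classicalMuVanishes)
    (hirr : W.HasIrreducibleModPGaloisRep 3) (himg : HasModPImageEqNonsplitCartanNormalizer W 3)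
    {c : absoluteGaloisGroup ℚ} (hc : IsComplexConjugation (Rat.castHom ℝ) c) (n : ℕ)
    (hrk : ∀ κE : ZpExtension ↥(fixedField (Subgroup.zpowers (absRestrictNormalHom (W.divisionField 3) c))) 3,
      κE.IsCyclotomic → classGroupPRank κE (n + 1) = classGroupPRank κE n)
    (κ : ZpExtension ℚ 3) (hκ : κ.IsCyclotomic) :
    ∃ (γ : absoluteGaloisGroup ℚ) (D : W.FineSelmerDualData κ γ),
      Module.Finite ℤ_[3] (RestrictScalars ℤ_[3] (IwasawaAlgebra 3) D.X) := by
  haveI : Fact (Nat.Prime 3) := ⟨Nat.prime_three⟩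
  haveI : NumberField ↥(W.divisionField 3) := NumberField.mk
  exact CartanMuRoadRealDoorsNoGrowth.conjA_three_of_hasModPImageEqNonsplitCartanNormalizer_of_realMu W hFW himg hc
    (fun κE hκE => classicalMuVanishes_of_classGroupPRank_succ_eq fukuda1994_thm1_classGroupPRank_const_of_succ_eq_holds κE
      (CartanMuRoadFukudaDoorsTprime.totallyRamifiedFrom_zero_intermediateField_divisionField W 3 hirr
        (not_hasSurjectiveModNGaloisRep_of_hasNonsplitCartanModPImage W himg.hasNonsplitCartanModPImage) _ κE hκE)
      (Nat.zero_le n) (hrk κE hκE)) κ hκ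

end FukudaDoors

/-! ### §2 KT: U₀ `MissingUpperBoundAt W 3` at a (t′) row through the Fukuda doors -/

section FukudaUpperTame

variable (W : WeierstrassCurve ℚ) [W.IsElliptic] [W.IsGloballyMinimal]

/-- **U₀ at a `3Ns` (t′) row from `ord₃ h(ℚ(P)_{n+1}) = ord₃ h(ℚ(P)_n)`**, modulo `hKatoA hGZK hmod hFW` (Fukuda (1) and Coates–Sujatha 3.4 discharged).
CONDITIONAL; nothing booked; BSD for no curve. [cite: Kato2004Asterisque, Thm. 14.5 (3) (p. 236)] [cite: Fukuda1994, Thm. 1 (1), p. 264] [cite: CoatesSujatha2005, Thm. 3.4 (§3)] -/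
theorem missingUpperBoundAt_three_tame_of_hasSplitCartanNormalizerModPImage_of_realSuccEqAt
    (hKatoA : Kato2004.rankZero_padicValNat_sha_add_padicValNat_tamagawa_le_of_additive_potGood_of_irreducible_of_fineSelmerDual_fg)
    (hGZK : rank_eq_analyticRank_of_analyticRank_le_one) (hmod : hasEntireLFunction_rat)
    (hFW : ferreroWashington1979_classicalMuVanishes) [Fact (3 : ℕ).Prime]
    (hr : W.analyticRank = 0) (hadd : Addv W 3) (hT : SubTprime W 3) (hirr : W.HasIrreducibleModPGaloisRep 3)
    (himg : HasSplitCartanNormalizerModPImage W 3) {c : absoluteGaloisGroup ℚ} (hc : IsComplexConjugation (Rat.castHom ℝ) c) (n : ℕ)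
    (hord : ∀ κE : ZpExtension ↥(fixedField (Subgroup.zpowers (absRestrictNormalHom (W.divisionField 3) c))) 3,
      κE.IsCyclotomic → classNumberPExp κE (n + 1) = classNumberPExp κE n) :
    MissingUpperBoundAt W 3 := by
  haveI : NumberField ↥(W.divisionField 3) := NumberField.mk
  exact CartanMuRoadRealDoorsNoGrowth.missingUpperBoundAt_three_tame_of_hasSplitCartanNormalizerModPImage_of_realMu W hKatoA hGZK
    hmod hFW hr hadd hT hirr himg hc
    (fun κE hκE => classicalMuVanishes_of_classNumberPExp_succ_eq fukuda1994_thm1_classNumberPExp_const_of_succ_eq_holds κE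
      (CartanMuRoadFukudaDoorsTprime.totallyRamifiedFrom_zero_intermediateField_divisionField W 3 hirr
        (CartanMuRoadFukudaDoorsTprime.not_hasSurjectiveModNGaloisRep_of_hasSplitCartanNormalizerModPImage W himg) _ κE hκE)
      (Nat.zero_le n) (hord κE hκE))

/-- **U₀ at a `3Ns` (t′) row from `rank₃ Cl(ℚ(P)_{n+1}) = rank₃ Cl(ℚ(P)_n)`**, modulo `hKatoA hGZK hmod hFW`. CONDITIONAL; nothing booked; BSD for no curve.
[cite: Kato2004Asterisque, Thm. 14.5 (3) (p. 236)] [cite: Fukuda1994, Thm. 1 (2), p. 264] [cite: CoatesSujatha2005, Thm. 3.4 (§3)] -/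
theorem missingUpperBoundAt_three_tame_of_hasSplitCartanNormalizerModPImage_of_realRankSuccEqAt
    (hKatoA : Kato2004.rankZero_padicValNat_sha_add_padicValNat_tamagawa_le_of_additive_potGood_of_irreducible_of_fineSelmerDual_fg)
    (hGZK : rank_eq_analyticRank_of_analyticRank_le_one) (hmod : hasEntireLFunction_rat)
    (hFW : ferreroWashington1979_classicalMuVanishes) [Fact (3 : ℕ).Prime]
    (hr : W.analyticRank = 0) (hadd : Addv W 3) (hT : SubTprime W 3) (hirr : W.HasIrreducibleModPGaloisRep 3)
    (himg : HasSplitCartanNormalizerModPImage W 3) {c : absoluteGaloisGroup ℚ} (hc : IsComplexConjugation (Rat.castHom ℝ) c) (n : ℕ)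
    (hrk : ∀ κE : ZpExtension ↥(fixedField (Subgroup.zpowers (absRestrictNormalHom (W.divisionField 3) c))) 3,
      κE.IsCyclotomic → classGroupPRank κE (n + 1) = classGroupPRank κE n) :
    MissingUpperBoundAt W 3 := by
  haveI : NumberField ↥(W.divisionField 3) := NumberField.mk
  exact CartanMuRoadRealDoorsNoGrowth.missingUpperBoundAt_three_tame_of_hasSplitCartanNormalizerModPImage_of_realMu W hKatoA hGZK
    hmod hFW hr hadd hT hirr himg hc
    (fun κE hκE => classicalMuVanishes_of_classGroupPRank_succ_eq fukuda1994_thm1_classGroupPRank_const_of_succ_eq_holds κE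
      (CartanMuRoadFukudaDoorsTprime.totallyRamifiedFrom_zero_intermediateField_divisionField W 3 hirr
        (CartanMuRoadFukudaDoorsTprime.not_hasSurjectiveModNGaloisRep_of_hasSplitCartanNormalizerModPImage W himg) _ κE hκE)
      (Nat.zero_le n) (hrk κE hκE))

/-- **U₀ at a `3Nn` (t′) row from `ord₃ h(ℚ(P)_{n+1}) = ord₃ h(ℚ(P)_n)` on the octic `ℚ(P)` alone — NO growth theorem**, modulo `hKatoA hGZK hmod hFW`
(the door for the 19 KT `3Nn` FUKUDA-L rows). CONDITIONAL; nothing booked; BSD for no curve. [cite: Kato2004Asterisque, Thm. 14.5 (3) (p. 236)]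
[cite: Fukuda1994, Thm. 1 (1), p. 264] [cite: CoatesSujatha2005, Thm. 3.4 (§3)] [cite: Washington1997, §13.3 Prop. 13.23] -/
theorem missingUpperBoundAt_three_tame_of_hasModPImageEqNonsplitCartanNormalizer_of_realSuccEqAt
    (hKatoA : Kato2004.rankZero_padicValNat_sha_add_padicValNat_tamagawa_le_of_additive_potGood_of_irreducible_of_fineSelmerDual_fg)
    (hGZK : rank_eq_analyticRank_of_analyticRank_le_one) (hmod : hasEntireLFunction_rat)
    (hFW : ferreroWashington1979_classicalMuVanishes) [Fact (3 : ℕ).Prime]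
    (hr : W.analyticRank = 0) (hadd : Addv W 3) (hT : SubTprime W 3) (hirr : W.HasIrreducibleModPGaloisRep 3)
    (himg : HasModPImageEqNonsplitCartanNormalizer W 3) {c : absoluteGaloisGroup ℚ} (hc : IsComplexConjugation (Rat.castHom ℝ) c) (n : ℕ)
    (hord : ∀ κE : ZpExtension ↥(fixedField (Subgroup.zpowers (absRestrictNormalHom (W.divisionField 3) c))) 3,
      κE.IsCyclotomic → classNumberPExp κE (n + 1) = classNumberPExp κE n) :
    MissingUpperBoundAt W 3 := by
  haveI : NumberField ↥(W.divisionField 3) := NumberField.mk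
  exact CartanMuRoadRealDoorsNoGrowth.missingUpperBoundAt_three_tame_of_hasModPImageEqNonsplitCartanNormalizer_of_realMu W hKatoA
    hGZK hmod hFW hr hadd hT hirr himg hc
    (fun κE hκE => classicalMuVanishes_of_classNumberPExp_succ_eq fukuda1994_thm1_classNumberPExp_const_of_succ_eq_holds κE
      (CartanMuRoadFukudaDoorsTprime.totallyRamifiedFrom_zero_intermediateField_divisionField W 3 hirr
        (not_hasSurjectiveModNGaloisRep_of_hasNonsplitCartanModPImage W himg.hasNonsplitCartanModPImage) _ κE hκE)
      (Nat.zero_le n) (hord κE hκE))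

/-- **U₀ at a `3Nn` (t′) row from `rank₃ Cl(ℚ(P)_{n+1}) = rank₃ Cl(ℚ(P)_n)` on the octic `ℚ(P)` alone — NO growth theorem**, modulo `hKatoA hGZK hmod hFW`
(the door for 198927v1, 486720db1, 486720dc1). CONDITIONAL; nothing booked; BSD for no curve. [cite: Kato2004Asterisque, Thm. 14.5 (3) (p. 236)]
[cite: Fukuda1994, Thm. 1 (2), p. 264] [cite: CoatesSujatha2005, Thm. 3.4 (§3)] [cite: Washington1997, §13.3 Prop. 13.23] -/
theorem missingUpperBoundAt_three_tame_of_hasModPImageEqNonsplitCartanNormalizer_of_realRankSuccEqAt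
    (hKatoA : Kato2004.rankZero_padicValNat_sha_add_padicValNat_tamagawa_le_of_additive_potGood_of_irreducible_of_fineSelmerDual_fg)
    (hGZK : rank_eq_analyticRank_of_analyticRank_le_one) (hmod : hasEntireLFunction_rat)
    (hFW : ferreroWashington1979_classicalMuVanishes) [Fact (3 : ℕ).Prime]
    (hr : W.analyticRank = 0) (hadd : Addv W 3) (hT : SubTprime W 3) (hirr : W.HasIrreducibleModPGaloisRep 3)
    (himg : HasModPImageEqNonsplitCartanNormalizer W 3) {c : absoluteGaloisGroup ℚ} (hc : IsComplexConjugation (Rat.castHom ℝ) c) (n : ℕ)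
    (hrk : ∀ κE : ZpExtension ↥(fixedField (Subgroup.zpowers (absRestrictNormalHom (W.divisionField 3) c))) 3,
      κE.IsCyclotomic → classGroupPRank κE (n + 1) = classGroupPRank κE n) :
    MissingUpperBoundAt W 3 := by
  haveI : NumberField ↥(W.divisionField 3) := NumberField.mk
  exact CartanMuRoadRealDoorsNoGrowth.missingUpperBoundAt_three_tame_of_hasModPImageEqNonsplitCartanNormalizer_of_realMu W hKatoA
    hGZK hmod hFW hr hadd hT hirr himg hc
    (fun κE hκE => classicalMuVanishes_of_classGroupPRank_succ_eq fukuda1994_thm1_classGroupPRank_const_of_succ_eq_holds κE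
      (CartanMuRoadFukudaDoorsTprime.totallyRamifiedFrom_zero_intermediateField_divisionField W 3 hirr
        (not_hasSurjectiveModNGaloisRep_of_hasNonsplitCartanModPImage W himg.hasNonsplitCartanModPImage) _ κE hκE)
      (Nat.zero_le n) (hrk κE hκE))

end FukudaUpperTame

end Summit.BirchSwinnertonDyer.BirchSwinnertonDyer.Theorems.CartanMuRoadFukudaDoorsNoGrowth

end
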